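import Literature.AlgebraicGeometry.HodgeTheory.LimitMixedHodgeStructureSl2TripleNaturality
import Literature.AlgebraicGeometry.HodgeTheory.MonodromyWeightFiltrationSumDual
import Literature.AlgebraicGeometry.Motives.MixedHodgeStructureProd
import HarnessLib

/-!
# Direct sums of limit mixed Hodge structures; additivity of `δ`, of the `δ`-splitting and of `(N⁺, H, N)`

The direct sum of two limit mixed Hodge structures `(V₁, W, F, N₁)`, `(V₂, W, F, N₂)` of the same central
weight `k` is the direct-sum MHS (Cattani–El Zein–Griffiths–Lê, *Hodge Theory*, Thm. 3.2.18, Ex. 3.2.23 (2); the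
tree's `MixedHodgeStructure.prod`) with `N = N₁ ⊕ N₂`: the monodromy weight filtration of a direct sum is the direct
sum of the monodromy weight filtrations (Deligne, *Weil II* (1.6.7); the tree's `IsMonodromyWeightFiltration.prod`),
and Lefschetz modules are closed under direct sums (Looijenga–Lunts §1 (1.1)). Since the four structure maps
`ι₁, ι₂, π₁, π₂` of the biproduct are MORPHISMS, everything natural is additive — this is how we obtain, without
any computation:

* §1 `MixedHodgeStructure.prodEquiv_delta_prod`: **Deligne's `δ` of a direct sum is `δ₁ ⊕ δ₂`** (Kato–Usui §6.1.2 (9),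
  Cattani–Kaplan–Schmid (2.20): `δ` commutes with morphisms), likewise `Y`, the automorphism `g` and `e^{-iδ}`;
  **`deltaSplit_prod`: the `δ`-splitting of `H₁ ⊕ H₂` is the direct sum of the `δ`-splittings**;
  `isSplitOverR_prod_iff` (`H₁ ⊕ H₂` is `ℝ`-split iff both summands are).
* §2 `LimitMixedHodgeStructure.prod` and its biproduct morphisms `fst`, `snd`, `inl`, `inr`, `prodLift`, `coprodDesc`.
* §3 **additivity of the `𝔰𝔩₂`-triple**: `prodEquiv_deligneH_prod`, `prodEquiv_nPlus_prod` (`H = H₁ ⊕ H₂`,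
  `N⁺ = N₁⁺ ⊕ N₂⁺`, by the naturality of `LimitMixedHodgeStructureSl2TripleNaturality.lean`), and the LMHS form of
  `deltaSplit_prod`.

All statements use the tree's identification `prodEquiv : ℂ ⊗ (V₁ × V₂) ≃ (ℂ ⊗ V₁) × (ℂ ⊗ V₂)`. Everything is proved;
no named fact, no instance.

## References

* [CattaniElZeinGriffithsLe2014] E. Cattani et al. (eds.), *Hodge Theory* (2014): Thm. 3.2.18, Ex. 3.2.23 (2),
  Def. 7.5.9, §7.5 (7.5.13)–(7.5.14).
* [Deligne1980] P. Deligne, *La conjecture de Weil II*, (1.6.7).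
* [LooijengaLunts1997] E. Looijenga, V. Lunts, Invent. Math. 129 (1997), §1 (1.1) (p. 4).
* [KatoUsui2009] K. Kato, S. Usui, Ann. of Math. Stud. 169 (2009), §6.1.2 (9).
* [CattaniKaplanSchmid1986] E. Cattani, A. Kaplan, W. Schmid, Ann. of Math. 123 (1986), Prop. (2.20).
-/

noncomputable section

open scoped TensorProduct

universe u

namespace Literature.AlgebraicGeometry.Motives.MixedHodgeStructure

open HodgeStructure (prodEquiv)

variable {V : Type u} [AddCommGroup V] [Module ℚ V]
variable {V' : Type u} [AddCommGroup V'] [Module ℚ V']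

/-! ## §0 Operators compatible with the biproduct maps act componentwise -/

/-- `prodEquiv⁻¹ (x, y) = ι₁ x + ι₂ y`. [folklore] -/
private theorem prodEquiv_symm_mk (x : ℂ ⊗[ℚ] V) (y : ℂ ⊗[ℚ] V') :
    (prodEquiv V V').symm (x, y) =
      (LinearMap.inl ℚ V V').baseChange ℂ x + (LinearMap.inr ℚ V V').baseChange ℂ y := by
  apply (prodEquiv V V').injective
  rw [LinearEquiv.apply_symm_apply, map_add, prodEquiv_inl_baseChange, prodEquiv_inr_baseChange, Prod.mk_add_mk,
    add_zero, zero_add]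

/-- An operator `T` on `ℂ ⊗ (V₁ × V₂)` with `T ι₁ = ι₁ T₁`, `T ι₂ = ι₂ T₂` is `T₁ ⊕ T₂` under `prodEquiv`. [folklore] -/
private theorem prodEquiv_apply_of_comp_inl_inr {T : Module.End ℂ (ℂ ⊗[ℚ] (V × V'))}
    {T₁ : Module.End ℂ (ℂ ⊗[ℚ] V)} {T₂ : Module.End ℂ (ℂ ⊗[ℚ] V')}
    (h₁ : T ∘ₗ (LinearMap.inl ℚ V V').baseChange ℂ = (LinearMap.inl ℚ V V').baseChange ℂ ∘ₗ T₁)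
    (h₂ : T ∘ₗ (LinearMap.inr ℚ V V').baseChange ℂ = (LinearMap.inr ℚ V V').baseChange ℂ ∘ₗ T₂)
    (z : ℂ ⊗[ℚ] (V × V')) :
    prodEquiv V V' (T z) = (T₁ (prodEquiv V V' z).1, T₂ (prodEquiv V V' z).2) := by
  obtain ⟨x, y, rfl⟩ : ∃ x y, z = (prodEquiv V V').symm (x, y) :=
    ⟨(prodEquiv V V' z).1, (prodEquiv V V' z).2, by rw [Prod.mk.eta, LinearEquiv.symm_apply_apply]⟩
  rw [LinearEquiv.apply_symm_apply, prodEquiv_symm_mk, map_add, ← LinearMap.comp_apply T, h₁,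
    ← LinearMap.comp_apply T, h₂, LinearMap.comp_apply, LinearMap.comp_apply, map_add, prodEquiv_inl_baseChange,
    prodEquiv_inr_baseChange, Prod.mk_add_mk, add_zero, zero_add]

/-- `N₁ ⊕ N₂` after base change is `N_{1,ℂ} ⊕ N_{2,ℂ}` under `prodEquiv`. [folklore] -/
private theorem prodEquiv_prodMap_baseChange' (f : V →ₗ[ℚ] V) (g : V' →ₗ[ℚ] V') (z : ℂ ⊗[ℚ] (V × V')) :
    prodEquiv V V' ((f.prodMap g).baseChange ℂ z) =
      (f.baseChange ℂ (prodEquiv V V' z).1, g.baseChange ℂ (prodEquiv V V' z).2) := by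
  refine prodEquiv_apply_of_comp_inl_inr ?_ ?_ z
  · rw [← LinearMap.baseChange_comp, ← LinearMap.baseChange_comp]
    exact congrArg _ (LinearMap.ext fun x => Prod.ext rfl (map_zero g))
  · rw [← LinearMap.baseChange_comp, ← LinearMap.baseChange_comp]
    exact congrArg _ (LinearMap.ext fun x => Prod.ext (map_zero f) rfl)

/-! ## §1 Deligne's `δ`, `Y`, `g` and the `δ`-splitting of a direct sum of mixed Hodge structures -/

section Delta

variable [FiniteDimensional ℚ V] [FiniteDimensional ℚ V'] (H₁ : MixedHodgeStructure V) (H₂ : MixedHodgeStructure V')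

/-- `Y(H₁ ⊕ H₂) ∘ ι₁ = ι₁ ∘ Y(H₁)`. [cite: CattaniElZeinGriffithsLe2014, Thm. 3.2.18 and (7.5.13)] -/
theorem deligneY_prod_comp_inl :
    (H₁.prod H₂).deligneY ∘ₗ (LinearMap.inl ℚ V V').baseChange ℂ = (LinearMap.inl ℚ V V').baseChange ℂ ∘ₗ H₁.deligneY :=
  (Hom.inl H₁ H₂).baseChange_comp_deligneY.symm

/-- `Y(H₁ ⊕ H₂) ∘ ι₂ = ι₂ ∘ Y(H₂)`. [cite: CattaniElZeinGriffithsLe2014, Thm. 3.2.18 and (7.5.13)] -/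
theorem deligneY_prod_comp_inr :
    (H₁.prod H₂).deligneY ∘ₗ (LinearMap.inr ℚ V V').baseChange ℂ = (LinearMap.inr ℚ V V').baseChange ℂ ∘ₗ H₂.deligneY :=
  (Hom.inr H₁ H₂).baseChange_comp_deligneY.symm

/-- **`Y(H₁ ⊕ H₂) = Y(H₁) ⊕ Y(H₂)`** (under `prodEquiv`). [cite: CattaniElZeinGriffithsLe2014, Thm. 3.2.18 and (7.5.13)] -/
theorem prodEquiv_deligneY_prod (z : ℂ ⊗[ℚ] (V × V')) :
    prodEquiv V V' ((H₁.prod H₂).deligneY z) =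
      (H₁.deligneY (prodEquiv V V' z).1, H₂.deligneY (prodEquiv V V' z).2) :=
  prodEquiv_apply_of_comp_inl_inr (H₁.deligneY_prod_comp_inl H₂) (H₁.deligneY_prod_comp_inr H₂) z

/-- `g(H₁ ⊕ H₂) ∘ ι₁ = ι₁ ∘ g(H₁)` for the automorphism `g = exp ε` of Kato–Usui §6.1.2. [cite: KatoUsui2009, §6.1.2 (9)] -/
theorem conjAut_prod_comp_inl :
    (H₁.prod H₂).conjAut ∘ₗ (LinearMap.inl ℚ V V').baseChange ℂ = (LinearMap.inl ℚ V V').baseChange ℂ ∘ₗ H₁.conjAut :=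
  (Hom.inl H₁ H₂).baseChange_comp_conjAut.symm

/-- `g(H₁ ⊕ H₂) ∘ ι₂ = ι₂ ∘ g(H₂)`. [cite: KatoUsui2009, §6.1.2 (9)] -/
theorem conjAut_prod_comp_inr :
    (H₁.prod H₂).conjAut ∘ₗ (LinearMap.inr ℚ V V').baseChange ℂ = (LinearMap.inr ℚ V V').baseChange ℂ ∘ₗ H₂.conjAut :=
  (Hom.inr H₁ H₂).baseChange_comp_conjAut.symm

/-- **`g(H₁ ⊕ H₂) = g(H₁) ⊕ g(H₂)`** (under `prodEquiv`). [cite: KatoUsui2009, §6.1.2 (9)] -/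
theorem prodEquiv_conjAut_prod (z : ℂ ⊗[ℚ] (V × V')) :
    prodEquiv V V' ((H₁.prod H₂).conjAut z) =
      (H₁.conjAut (prodEquiv V V' z).1, H₂.conjAut (prodEquiv V V' z).2) :=
  prodEquiv_apply_of_comp_inl_inr (H₁.conjAut_prod_comp_inl H₂) (H₁.conjAut_prod_comp_inr H₂) z

/-- `δ(H₁ ⊕ H₂) ∘ ι₁ = ι₁ ∘ δ(H₁)`. [cite: KatoUsui2009, §6.1.2 (9)] [cite: CattaniKaplanSchmid1986, Prop. (2.20)] -/
theorem delta_prod_comp_inl :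
    (H₁.prod H₂).delta ∘ₗ (LinearMap.inl ℚ V V').baseChange ℂ = (LinearMap.inl ℚ V V').baseChange ℂ ∘ₗ H₁.delta :=
  (Hom.inl H₁ H₂).baseChange_comp_delta.symm

/-- `δ(H₁ ⊕ H₂) ∘ ι₂ = ι₂ ∘ δ(H₂)`. [cite: KatoUsui2009, §6.1.2 (9)] [cite: CattaniKaplanSchmid1986, Prop. (2.20)] -/
theorem delta_prod_comp_inr :
    (H₁.prod H₂).delta ∘ₗ (LinearMap.inr ℚ V V').baseChange ℂ = (LinearMap.inr ℚ V V').baseChange ℂ ∘ₗ H₂.delta :=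
  (Hom.inr H₁ H₂).baseChange_comp_delta.symm

/-- `π₁ ∘ δ(H₁ ⊕ H₂) = δ(H₁) ∘ π₁`. [cite: KatoUsui2009, §6.1.2 (9)] [cite: CattaniKaplanSchmid1986, Prop. (2.20)] -/
theorem fst_comp_delta_prod :
    (LinearMap.fst ℚ V V').baseChange ℂ ∘ₗ (H₁.prod H₂).delta = H₁.delta ∘ₗ (LinearMap.fst ℚ V V').baseChange ℂ :=
  (Hom.fst H₁ H₂).baseChange_comp_delta

/-- `π₂ ∘ δ(H₁ ⊕ H₂) = δ(H₂) ∘ π₂`. [cite: KatoUsui2009, §6.1.2 (9)] [cite: CattaniKaplanSchmid1986, Prop. (2.20)] -/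
theorem snd_comp_delta_prod :
    (LinearMap.snd ℚ V V').baseChange ℂ ∘ₗ (H₁.prod H₂).delta = H₂.delta ∘ₗ (LinearMap.snd ℚ V V').baseChange ℂ :=
  (Hom.snd H₁ H₂).baseChange_comp_delta

/-- **Deligne's `δ` is additive: `δ(H₁ ⊕ H₂) = δ(H₁) ⊕ δ(H₂)`** (under `prodEquiv`) — because `δ` commutes with the
morphisms `ι₁, ι₂` (Kato–Usui (9); Cattani–Kaplan–Schmid (2.20)). [cite: KatoUsui2009, §6.1.2 (9)]
[cite: CattaniKaplanSchmid1986, Prop. (2.20)] -/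
theorem prodEquiv_delta_prod (z : ℂ ⊗[ℚ] (V × V')) :
    prodEquiv V V' ((H₁.prod H₂).delta z) = (H₁.delta (prodEquiv V V' z).1, H₂.delta (prodEquiv V V' z).2) :=
  prodEquiv_apply_of_comp_inl_inr (H₁.delta_prod_comp_inl H₂) (H₁.delta_prod_comp_inr H₂) z

/-- **`e^{-iδ(H₁ ⊕ H₂)} = e^{-iδ(H₁)} ⊕ e^{-iδ(H₂)}`** (under `prodEquiv`). [cite: CattaniKaplanSchmid1986, Prop. (2.20)]
[cite: KatoUsui2009, §6.1.2 (9)–(10)] -/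
theorem prodEquiv_exp_neg_I_smul_delta_prod (z : ℂ ⊗[ℚ] (V × V')) :
    prodEquiv V V' (IsNilpotent.exp (-Complex.I • (H₁.prod H₂).delta) z) =
      (IsNilpotent.exp (-Complex.I • H₁.delta) (prodEquiv V V' z).1,
        IsNilpotent.exp (-Complex.I • H₂.delta) (prodEquiv V V' z).2) :=
  prodEquiv_apply_of_comp_inl_inr (Hom.inl H₁ H₂).baseChange_comp_exp_neg_I_smul_delta.symm
    (Hom.inr H₁ H₂).baseChange_comp_exp_neg_I_smul_delta.symm z

/-- **`δ(H₁ ⊕ H₂) = 0 ↔ δ(H₁) = 0 ∧ δ(H₂) = 0`.** [cite: KatoUsui2009, §6.1.2 (9)–(10)] -/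
theorem delta_prod_eq_zero_iff : (H₁.prod H₂).delta = 0 ↔ H₁.delta = 0 ∧ H₂.delta = 0 := by
  constructor
  · intro h
    refine ⟨LinearMap.ext fun x => ?_, LinearMap.ext fun y => ?_⟩
    · have h1 := LinearMap.congr_fun (H₁.delta_prod_comp_inl H₂) x
      rw [h, LinearMap.zero_comp, LinearMap.zero_apply, LinearMap.comp_apply] at h1
      have h2 := congrArg (fun w => (prodEquiv V V' w).1) h1
      simp only [map_zero, Prod.fst_zero, prodEquiv_inl_baseChange] at h2
      rw [LinearMap.zero_apply, ← h2]
    · have h1 := LinearMap.congr_fun (H₁.delta_prod_comp_inr H₂) y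
      rw [h, LinearMap.zero_comp, LinearMap.zero_apply, LinearMap.comp_apply] at h1
      have h2 := congrArg (fun w => (prodEquiv V V' w).2) h1
      simp only [map_zero, Prod.snd_zero, prodEquiv_inr_baseChange] at h2
      rw [LinearMap.zero_apply, ← h2]
  · rintro ⟨h₁, h₂⟩
    refine LinearMap.ext fun z => (prodEquiv V V').injective ?_
    rw [prodEquiv_delta_prod, h₁, h₂, LinearMap.zero_apply, LinearMap.zero_apply, LinearMap.zero_apply, map_zero,
      Prod.mk_zero_zero]

/-- **A direct sum is `ℝ`-split iff both summands are** (`δ = 0 ↔ split`, Cattani–Kaplan–Schmid (2.20);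
the tree's `IsSplitOverR.prod` is the direction `⇐`). [cite: CattaniKaplanSchmid1986, Prop. (2.20)] [cite: KatoUsui2009, §6.1.2 (10)] -/
theorem isSplitOverR_prod_iff : (H₁.prod H₂).IsSplitOverR ↔ H₁.IsSplitOverR ∧ H₂.IsSplitOverR := by
  rw [← delta_eq_zero_iff, ← delta_eq_zero_iff, ← delta_eq_zero_iff, delta_prod_eq_zero_iff]

/-- **The `δ`-splitting is additive: `(H₁ ⊕ H₂)^ = Ĥ₁ ⊕ Ĥ₂`**, i.e.
`(W, e^{-iδ}F)(H₁ ⊕ H₂) = (W, e^{-iδ₁}F₁) ⊕ (W, e^{-iδ₂}F₂)` ("`(W,F) ↦ (W, e^{-iδ}F)` is a functor", applied to the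
biproduct diagram). [cite: CattaniKaplanSchmid1986, Prop. (2.20)] [cite: KatoUsui2009, §6.1.2 (9)–(10)]
[cite: CattaniElZeinGriffithsLe2014, Ex. 3.2.23 (2)] -/
theorem deltaSplit_prod : (H₁.prod H₂).deltaSplit = H₁.deltaSplit.prod H₂.deltaSplit := by
  refine ext_of_W_F rfl (funext fun p => ?_)
  rw [deltaSplit_F, prod_F, prod_F, deltaSplit_F, deltaSplit_F]
  ext z
  simp only [Submodule.mem_map, Submodule.mem_comap, Submodule.mem_prod, LinearEquiv.coe_coe]
  constructor
  · rintro ⟨w, ⟨hw₁, hw₂⟩, rfl⟩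
    rw [prodEquiv_exp_neg_I_smul_delta_prod]
    exact ⟨⟨_, hw₁, rfl⟩, ⟨_, hw₂, rfl⟩⟩
  · rintro ⟨⟨a, ha, hax⟩, ⟨b, hb, hby⟩⟩
    refine ⟨(prodEquiv V V').symm (a, b), ?_, (prodEquiv V V').injective ?_⟩
    · rw [LinearEquiv.apply_symm_apply]
      exact ⟨ha, hb⟩
    · rw [prodEquiv_exp_neg_I_smul_delta_prod, LinearEquiv.apply_symm_apply, hax, hby, Prod.mk.eta]

end Delta

end Literature.AlgebraicGeometry.Motives.MixedHodgeStructure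

namespace Literature.AlgebraicGeometry.HodgeTheory

open Motives Motives.MixedHodgeStructure
open Motives.HodgeStructure (prodEquiv)
open Literature.AlgebraicGeometry.Motives.MixedHodgeStructure (prodEquiv_inl_baseChange prodEquiv_inr_baseChange)

variable {V : Type u} [AddCommGroup V] [Module ℚ V] {V' : Type u} [AddCommGroup V'] [Module ℚ V'] {k : ℤ}

namespace LimitMixedHodgeStructure

/-! ## §2 The direct sum of two limit mixed Hodge structures -/

/-- `N₁ ⊕ N₂` is nilpotent. [folklore] -/
private theorem isNilpotent_prodMap {N₁ : V →ₗ[ℚ] V} {N₂ : V' →ₗ[ℚ] V'} (h₁ : IsNilpotent N₁)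
    (h₂ : IsNilpotent N₂) : IsNilpotent (N₁.prodMap N₂) := by
  obtain ⟨n, hn⟩ := h₁
  obtain ⟨m, hm⟩ := h₂
  refine ⟨n + m, ?_⟩
  have hpow : ∀ j : ℕ, (N₁.prodMap N₂) ^ j = (N₁ ^ j).prodMap (N₂ ^ j) := fun j => by
    induction j with
    | zero => rw [pow_zero, pow_zero, pow_zero, LinearMap.prodMap_one]
    | succ j ih => rw [pow_succ, ih, pow_succ, pow_succ, LinearMap.prodMap_mul]
  rw [hpow, pow_add, hn, zero_mul, pow_add, hm, mul_zero, LinearMap.prodMap_zero]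

/-- **The direct sum `L₁ ⊕ L₂` of two limit mixed Hodge structures of central weight `k`**: the direct-sum MHS
(`W_k(L₁) × W_k(L₂)`, `F^p(L₁) × F^p(L₂)`) with `N = N₁ ⊕ N₂`; `W(N₁ ⊕ N₂) = W(N₁) ⊕ W(N₂)` by Deligne (1.6.7).
[cite: CattaniElZeinGriffithsLe2014, Ex. 3.2.23 (2) and Def. 7.5.9] [cite: Deligne1980, (1.6.7)]
[cite: LooijengaLunts1997, §1 (1.1) p. 4 (closed under direct sums)] -/
def prod (L₁ : LimitMixedHodgeStructure V k) (L₂ : LimitMixedHodgeStructure V' k) :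
    LimitMixedHodgeStructure (V × V') k where
  toMixedHodgeStructure := L₁.toMixedHodgeStructure.prod L₂.toMixedHodgeStructure
  N := L₁.N.prodMap L₂.N
  isNilpotent_N := isNilpotent_prodMap L₁.isNilpotent_N L₂.isNilpotent_N
  map_N_F_le p := by
    rintro _ ⟨z, hz, rfl⟩
    change prodEquiv V V' z ∈ (L₁.F p).prod (L₂.F p) at hz
    change prodEquiv V V' ((L₁.N.prodMap L₂.N).baseChange ℂ z) ∈ (L₁.F (p - 1)).prod (L₂.F (p - 1))
    rw [Motives.MixedHodgeStructure.prodEquiv_prodMap_baseChange']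
    exact ⟨L₁.map_N_F_le p ⟨_, hz.1, rfl⟩, L₂.map_N_F_le p ⟨_, hz.2, rfl⟩⟩
  isMonodromyWeightFiltration := L₁.isMonodromyWeightFiltration.prod L₂.isMonodromyWeightFiltration

variable (L₁ : LimitMixedHodgeStructure V k) (L₂ : LimitMixedHodgeStructure V' k)

/-- The underlying MHS of `L₁ ⊕ L₂` is the direct-sum MHS. [cite: CattaniElZeinGriffithsLe2014, Ex. 3.2.23 (2)] -/
@[simp]
theorem prod_toMixedHodgeStructure :
    (L₁.prod L₂).toMixedHodgeStructure = L₁.toMixedHodgeStructure.prod L₂.toMixedHodgeStructure := rfl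

/-- `N(L₁ ⊕ L₂) = N₁ ⊕ N₂`. [cite: CattaniElZeinGriffithsLe2014, Def. 7.5.9] -/
@[simp]
theorem prod_N : (L₁.prod L₂).N = L₁.N.prodMap L₂.N := rfl

/-- `W_i(L₁ ⊕ L₂) = W_i(L₁) × W_i(L₂)`. [cite: Deligne1980, (1.6.7)] -/
theorem prod_W (i : ℤ) : (L₁.prod L₂).W i = (L₁.W i).prod (L₂.W i) := rfl

/-- `F^p(L₁ ⊕ L₂) = F^p(L₁) × F^p(L₂)` under `prodEquiv`. [cite: CattaniElZeinGriffithsLe2014, Ex. 3.2.23 (2)] -/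
theorem prod_F (p : ℤ) :
    (L₁.prod L₂).F p = ((L₁.F p).prod (L₂.F p)).comap (prodEquiv V V' : ℂ ⊗[ℚ] (V × V') →ₗ[ℂ] _) := rfl

/-- `N_ℂ(L₁ ⊕ L₂) = N_{1,ℂ} ⊕ N_{2,ℂ}` under `prodEquiv`. [cite: CattaniElZeinGriffithsLe2014, Def. 7.5.9] -/
theorem prodEquiv_N_baseChange_prod (z : ℂ ⊗[ℚ] (V × V')) :
    prodEquiv V V' ((L₁.prod L₂).N.baseChange ℂ z) =
      (L₁.N.baseChange ℂ (prodEquiv V V' z).1, L₂.N.baseChange ℂ (prodEquiv V V' z).2) :=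
  Motives.MixedHodgeStructure.prodEquiv_prodMap_baseChange' L₁.N L₂.N z

namespace Hom

/-- The first projection `L₁ ⊕ L₂ → L₁` is a morphism of limit MHS. [cite: CattaniElZeinGriffithsLe2014, Thm. 3.2.18 and Def. 7.5.9] -/
def fst : Hom (L₁.prod L₂) L₁ where
  toHom := Motives.MixedHodgeStructure.Hom.fst L₁.toMixedHodgeStructure L₂.toMixedHodgeStructure
  comm_N := LinearMap.ext fun _ => rfl

/-- The second projection `L₁ ⊕ L₂ → L₂` is a morphism of limit MHS. [cite: CattaniElZeinGriffithsLe2014, Thm. 3.2.18 and Def. 7.5.9] -/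
def snd : Hom (L₁.prod L₂) L₂ where
  toHom := Motives.MixedHodgeStructure.Hom.snd L₁.toMixedHodgeStructure L₂.toMixedHodgeStructure
  comm_N := LinearMap.ext fun _ => rfl

/-- The first injection `L₁ → L₁ ⊕ L₂` is a morphism of limit MHS. [cite: CattaniElZeinGriffithsLe2014, Thm. 3.2.18 and Def. 7.5.9] -/
def inl : Hom L₁ (L₁.prod L₂) where
  toHom := Motives.MixedHodgeStructure.Hom.inl L₁.toMixedHodgeStructure L₂.toMixedHodgeStructure
  comm_N := LinearMap.ext fun _ => Prod.ext rfl (map_zero L₂.N).symm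

/-- The second injection `L₂ → L₁ ⊕ L₂` is a morphism of limit MHS. [cite: CattaniElZeinGriffithsLe2014, Thm. 3.2.18 and Def. 7.5.9] -/
def inr : Hom L₂ (L₁.prod L₂) where
  toHom := Motives.MixedHodgeStructure.Hom.inr L₁.toMixedHodgeStructure L₂.toMixedHodgeStructure
  comm_N := LinearMap.ext fun _ => Prod.ext (map_zero L₁.N).symm rfl

/-- Underlying map of `π₁`. [cite: CattaniElZeinGriffithsLe2014, Thm. 3.2.18] -/
@[simp] theorem fst_toLinearMap : (fst L₁ L₂).toLinearMap = LinearMap.fst ℚ V V' := rfl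

/-- Underlying map of `π₂`. [cite: CattaniElZeinGriffithsLe2014, Thm. 3.2.18] -/
@[simp] theorem snd_toLinearMap : (snd L₁ L₂).toLinearMap = LinearMap.snd ℚ V V' := rfl

/-- Underlying map of `ι₁`. [cite: CattaniElZeinGriffithsLe2014, Thm. 3.2.18] -/
@[simp] theorem inl_toLinearMap : (inl L₁ L₂).toLinearMap = LinearMap.inl ℚ V V' := rfl

/-- Underlying map of `ι₂`. [cite: CattaniElZeinGriffithsLe2014, Thm. 3.2.18] -/
@[simp] theorem inr_toLinearMap : (inr L₁ L₂).toLinearMap = LinearMap.inr ℚ V V' := rfl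

variable {L₁ L₂} {U : Type u} [AddCommGroup U] [Module ℚ U] {L : LimitMixedHodgeStructure U k}

/-- The universal morphism `L → L₁ ⊕ L₂` from `f : L → L₁`, `g : L → L₂`. [cite: CattaniElZeinGriffithsLe2014, Thm. 3.2.18 and Def. 7.5.9] -/
def prodLift (f : Hom L L₁) (g : Hom L L₂) : Hom L (L₁.prod L₂) where
  toHom := Motives.MixedHodgeStructure.Hom.prodLift f.toHom g.toHom
  comm_N := by
    refine LinearMap.ext fun x => Prod.ext ?_ ?_
    · exact LinearMap.congr_fun f.comm_N x
    · exact LinearMap.congr_fun g.comm_N x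

/-- The universal morphism `L₁ ⊕ L₂ → L` from `f : L₁ → L`, `g : L₂ → L`. [cite: CattaniElZeinGriffithsLe2014, Thm. 3.2.18 and Def. 7.5.9] -/
def coprodDesc (f : Hom L₁ L) (g : Hom L₂ L) : Hom (L₁.prod L₂) L where
  toHom := Motives.MixedHodgeStructure.Hom.coprodDesc f.toHom g.toHom
  comm_N := by
    refine LinearMap.ext fun x => ?_
    have h₁ := LinearMap.congr_fun f.comm_N x.1
    have h₂ := LinearMap.congr_fun g.comm_N x.2
    simp only [LinearMap.comp_apply] at h₁ h₂
    change f.toLinearMap (L₁.N x.1) + g.toLinearMap (L₂.N x.2) = L.N (f.toLinearMap x.1 + g.toLinearMap x.2)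
    rw [h₁, h₂, map_add]

/-- Underlying map of `⟨f, g⟩ : L → L₁ ⊕ L₂`. [cite: CattaniElZeinGriffithsLe2014, Thm. 3.2.18] -/
@[simp] theorem prodLift_toLinearMap (f : Hom L L₁) (g : Hom L L₂) :
    (prodLift f g).toLinearMap = f.toLinearMap.prod g.toLinearMap := rfl

/-- Underlying map of `[f, g] : L₁ ⊕ L₂ → L`. [cite: CattaniElZeinGriffithsLe2014, Thm. 3.2.18] -/
@[simp] theorem coprodDesc_toLinearMap (f : Hom L₁ L) (g : Hom L₂ L) :
    (coprodDesc f g).toLinearMap = f.toLinearMap.coprod g.toLinearMap := rfl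

/-- `π₁ ∘ ι₁ = id`. [cite: CattaniElZeinGriffithsLe2014, Thm. 3.2.18] -/
theorem fst_toLinearMap_comp_inl : (fst L₁ L₂).toLinearMap ∘ₗ (inl L₁ L₂).toLinearMap = LinearMap.id :=
  LinearMap.fst_comp_inl ..

/-- `π₂ ∘ ι₂ = id`. [cite: CattaniElZeinGriffithsLe2014, Thm. 3.2.18] -/
theorem snd_toLinearMap_comp_inr : (snd L₁ L₂).toLinearMap ∘ₗ (inr L₁ L₂).toLinearMap = LinearMap.id :=
  LinearMap.snd_comp_inr ..

/-- `π₁ ∘ ι₂ = 0`. [cite: CattaniElZeinGriffithsLe2014, Thm. 3.2.18] -/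
theorem fst_toLinearMap_comp_inr : (fst L₁ L₂).toLinearMap ∘ₗ (inr L₁ L₂).toLinearMap = 0 :=
  LinearMap.fst_comp_inr ..

/-- `π₂ ∘ ι₁ = 0`. [cite: CattaniElZeinGriffithsLe2014, Thm. 3.2.18] -/
theorem snd_toLinearMap_comp_inl : (snd L₁ L₂).toLinearMap ∘ₗ (inl L₁ L₂).toLinearMap = 0 :=
  LinearMap.snd_comp_inl ..

end Hom

/-! ## §3 Additivity of `H`, `N⁺` and of the `δ`-splitting -/

section Sl2

variable [FiniteDimensional ℚ V] [FiniteDimensional ℚ V']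

/-- `H(L₁ ⊕ L₂) ∘ ι₁ = ι₁ ∘ H(L₁)`. [cite: CattaniElZeinGriffithsLe2014, §7.5 (7.5.13) and Thm. 3.2.18] -/
theorem deligneH_prod_comp_inl :
    (L₁.prod L₂).deligneH ∘ₗ (LinearMap.inl ℚ V V').baseChange ℂ = (LinearMap.inl ℚ V V').baseChange ℂ ∘ₗ L₁.deligneH :=
  (Hom.inl L₁ L₂).baseChange_comp_deligneH.symm

/-- `H(L₁ ⊕ L₂) ∘ ι₂ = ι₂ ∘ H(L₂)`. [cite: CattaniElZeinGriffithsLe2014, §7.5 (7.5.13) and Thm. 3.2.18] -/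
theorem deligneH_prod_comp_inr :
    (L₁.prod L₂).deligneH ∘ₗ (LinearMap.inr ℚ V V').baseChange ℂ = (LinearMap.inr ℚ V V').baseChange ℂ ∘ₗ L₂.deligneH :=
  (Hom.inr L₁ L₂).baseChange_comp_deligneH.symm

/-- **`H(L₁ ⊕ L₂) = H(L₁) ⊕ H(L₂)`** (under `prodEquiv`). [cite: CattaniElZeinGriffithsLe2014, §7.5 (7.5.13) and Thm. 3.2.18] -/
theorem prodEquiv_deligneH_prod (z : ℂ ⊗[ℚ] (V × V')) :
    prodEquiv V V' ((L₁.prod L₂).deligneH z) =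
      (L₁.deligneH (prodEquiv V V' z).1, L₂.deligneH (prodEquiv V V' z).2) :=
  Motives.MixedHodgeStructure.prodEquiv_apply_of_comp_inl_inr (L₁.deligneH_prod_comp_inl L₂)
    (L₁.deligneH_prod_comp_inr L₂) z

/-- `N⁺(L₁ ⊕ L₂) ∘ ι₁ = ι₁ ∘ N⁺(L₁)`. [cite: LooijengaLunts1997, §1 (1.1) p. 4] [cite: CattaniElZeinGriffithsLe2014, §7.5 (7.5.13)–(7.5.14)] -/
theorem nPlus_prod_comp_inl :
    (L₁.prod L₂).nPlus ∘ₗ (LinearMap.inl ℚ V V').baseChange ℂ = (LinearMap.inl ℚ V V').baseChange ℂ ∘ₗ L₁.nPlus :=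
  (Hom.inl L₁ L₂).baseChange_comp_nPlus.symm

/-- `N⁺(L₁ ⊕ L₂) ∘ ι₂ = ι₂ ∘ N⁺(L₂)`. [cite: LooijengaLunts1997, §1 (1.1) p. 4] [cite: CattaniElZeinGriffithsLe2014, §7.5 (7.5.13)–(7.5.14)] -/
theorem nPlus_prod_comp_inr :
    (L₁.prod L₂).nPlus ∘ₗ (LinearMap.inr ℚ V V').baseChange ℂ = (LinearMap.inr ℚ V V').baseChange ℂ ∘ₗ L₂.nPlus :=
  (Hom.inr L₁ L₂).baseChange_comp_nPlus.symm

/-- `π₁ ∘ N⁺(L₁ ⊕ L₂) = N⁺(L₁) ∘ π₁`. [cite: LooijengaLunts1997, §1 (1.1) p. 4] -/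
theorem fst_comp_nPlus_prod :
    (LinearMap.fst ℚ V V').baseChange ℂ ∘ₗ (L₁.prod L₂).nPlus = L₁.nPlus ∘ₗ (LinearMap.fst ℚ V V').baseChange ℂ :=
  (Hom.fst L₁ L₂).baseChange_comp_nPlus

/-- `π₂ ∘ N⁺(L₁ ⊕ L₂) = N⁺(L₂) ∘ π₂`. [cite: LooijengaLunts1997, §1 (1.1) p. 4] -/
theorem snd_comp_nPlus_prod :
    (LinearMap.snd ℚ V V').baseChange ℂ ∘ₗ (L₁.prod L₂).nPlus = L₂.nPlus ∘ₗ (LinearMap.snd ℚ V V').baseChange ℂ :=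
  (Hom.snd L₁ L₂).baseChange_comp_nPlus

/-- **The `𝔰𝔩₂`-triple is additive: `N⁺(L₁ ⊕ L₂) = N⁺(L₁) ⊕ N⁺(L₂)`** (under `prodEquiv`; Lefschetz modules and
their `𝔰𝔩₂`-actions are closed under direct sums, the partner being natural). [cite: LooijengaLunts1997, §1 (1.1) p. 4]
[cite: CattaniElZeinGriffithsLe2014, §7.5 (7.5.13)–(7.5.14)] -/
theorem prodEquiv_nPlus_prod (z : ℂ ⊗[ℚ] (V × V')) :
    prodEquiv V V' ((L₁.prod L₂).nPlus z) = (L₁.nPlus (prodEquiv V V' z).1, L₂.nPlus (prodEquiv V V' z).2) :=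
  Motives.MixedHodgeStructure.prodEquiv_apply_of_comp_inl_inr (L₁.nPlus_prod_comp_inl L₂)
    (L₁.nPlus_prod_comp_inr L₂) z

/-- **Deligne's `δ` of `L₁ ⊕ L₂` is `δ₁ ⊕ δ₂`** (under `prodEquiv`). [cite: KatoUsui2009, §6.1.2 (9)]
[cite: CattaniKaplanSchmid1986, Prop. (2.20)] -/
theorem prodEquiv_delta_prod (z : ℂ ⊗[ℚ] (V × V')) :
    prodEquiv V V' ((L₁.prod L₂).toMixedHodgeStructure.delta z) =
      (L₁.toMixedHodgeStructure.delta (prodEquiv V V' z).1, L₂.toMixedHodgeStructure.delta (prodEquiv V V' z).2) :=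
  L₁.toMixedHodgeStructure.prodEquiv_delta_prod L₂.toMixedHodgeStructure z

omit [FiniteDimensional ℚ V] [FiniteDimensional ℚ V'] in
/-- Two limit MHS with the same underlying MHS and the same `N` are equal. [cite: CattaniElZeinGriffithsLe2014, Def. 7.5.9] -/
theorem ext_of_toMixedHodgeStructure_N {L L' : LimitMixedHodgeStructure V k}
    (h : L.toMixedHodgeStructure = L'.toMixedHodgeStructure) (hN : L.N = L'.N) : L = L' := by
  obtain ⟨M, N, _, _, _⟩ := L
  obtain ⟨M', N', _, _, _⟩ := L'
  simp only at h hN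
  subst h hN
  rfl

/-- **The `δ`-splitting of limit MHS is additive: `(L₁ ⊕ L₂)^ = L̂₁ ⊕ L̂₂`** (same `N = N₁ ⊕ N₂`).
[cite: CattaniKaplanSchmid1986, Prop. (2.20)] [cite: KatoUsui2009, §6.1.2 (9)–(10)] -/
theorem deltaSplit_prod : (L₁.prod L₂).deltaSplit = L₁.deltaSplit.prod L₂.deltaSplit :=
  ext_of_toMixedHodgeStructure_N
    (by rw [deltaSplit_toMixedHodgeStructure, prod_toMixedHodgeStructure, prod_toMixedHodgeStructure,
      Motives.MixedHodgeStructure.deltaSplit_prod, deltaSplit_toMixedHodgeStructure, deltaSplit_toMixedHodgeStructure])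
    rfl

/-- **`L₁ ⊕ L₂` is `ℝ`-split iff `L₁` and `L₂` are.** [cite: CattaniKaplanSchmid1986, Prop. (2.20)] -/
theorem isSplitOverR_prod_iff :
    (L₁.prod L₂).toMixedHodgeStructure.IsSplitOverR ↔
      L₁.toMixedHodgeStructure.IsSplitOverR ∧ L₂.toMixedHodgeStructure.IsSplitOverR :=
  L₁.toMixedHodgeStructure.isSplitOverR_prod_iff L₂.toMixedHodgeStructure

end Sl2

end LimitMixedHodgeStructure

end Literature.AlgebraicGeometry.HodgeTheory

end
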